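import Summits.QuantumFields.BalabanUV.Beta.GAN24.DerivativeRateTransferNoLegs
import Summits.QuantumFields.BalabanUV.Beta.GAN24.DerivativeRateTransferSqueezeEnd

/-!
# `BalabanUV.Beta.GAN24.DerivativeRateTransferKKTSources` — binder row G-an2-4 ∕ (CONV-C), route R6 «VALUES, NOT DERIVATIVES», PART 42:
# KKT POINTS WITH SOURCES — the bordered resolvent identity for TWO fine forms at ONE constraint, its GRAM («Pythagoras») form, the squeeze
# of the constrained `(Λ − H)`-energy of every `Λ`-KKT point by the two diagonal rows of the bordered difference, and «JETS ARE KKT POINTS WITH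
# SOURCES» (an1's `dMinOp`, `jet₂` read as `𝒢·f + ℋ·u`) — the one-level form of the jet-range consistency row (CONS♭) (unit b2b-balaban-gan24-p3,
# gen 40; v1)

NOT IN PRINT; OUR PROOF (for the ROUTE; [folklore] finite-dimensional linear algebra over an2's bordered letters `Beta.Composition.kkt`,
`Beta.CompositionSingular.{effForm, minOp, minOpL, flucCov}` and an1's jet letters `Beta.BorderedJets.{dMinOp, dEffForm, jet₂}` BY NAME; PART 18
`DerivativeRateTransferLoewnerKKT.{transpose_eq_of_posSemidef, mulVec_dotProduct_eq}` and PART 32 `DerivativeRateTransferSqueezeEnd.dotProduct_mulVec_add_le`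
BY NAME).  CREDIT: the identity of §3 and the squeeze are gan24-idea-1 g49's LENS ITEM 6 «KKT PYTHAGORAS WITH SOURCES» (`ROUTES-GAN24.md` v49 R6 NOTE (a)(b);
scratch `records-g49/sketch/KKTSourcesSketch.lean` 2ce3cd7b22b71849 in gan24-p4's `MonotoneCoarsen.qfun` letters, rc 0, NOT proposed under FREEZE (0)) —
re-typed here as MATRIX identities in the route's bordered letters (singular fine forms allowed; only the bordered matrices nonsingular).  HONEST FRAMING
(cell contract, verbatim): «discharging `BetaPertH` makes Bałaban's UV stability UNCONDITIONAL — a real constructive-QFT result; it is NOT the continuum limit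
and NOT the Clay problem.»  HONEST DEPENDENCY (verbatim): «continuum YM on T⁴ ⇐ BetaPertH ∧ nine spine estimates (0/9 proved); BetaPertH ⇐ (D1) ∧ (D4) ∧
CAP+tail; G-an2-4 gates asym, D1 and NE2/3/4.»

WHY THIS FILE.  PART 41 (`effForm_tower_step_sub`) writes the tower step of the effective forms as the sandwich `ℋᴸ_j · D_j · ℋ̃_j` of the ONE-STEP FORM
DEFECT `D_j := 𝒮(H_{j+1}, Qf_j) − H_j` (`Λ_j := 𝒮(H_{j+1}, Qf_j)`, `ℋ̃_j := Qf_j·ℋ_{j+1} = ℋ(Λ_j, Qc_j)`); its s-jets are Leibniz sums whose leg terms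
(I, III at first order; T200, T002, T101 at second) are products of two `D_j`-seminorms of minimiser-JET vectors.  Their flat pricing rests on the support
row (CONS♭) «`⟨ℋ̃_{j,1}e, D_j ℋ̃_{j,1}e⟩ ≤ c·θ^j·‖e‖²`» (ROUTES-GAN24 v48 R6 NOTE (b); PRICING-GAN24 v3.42: OPEN, no holder).  THIS FILE types the
one-level mechanism that reduces (CONS♭) to two DIAGONAL rows of the bordered difference: with `B_K := (kkt K Q)⁻¹ = [[𝒢_K, ℋ_K],[ℋᴸ_K, −𝒮_K]]`,
`E := kkt (Λ − H) 0`: (R) `B_H − B_Λ = B_H·E·B_Λ = B_Λ·E·B_H`; (G) `B_H − B_Λ = B_Λ·E·B_Λ + B_Λ·E·B_H·E·B_Λ` (any field, no symmetry); for symmetric real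
data at a source `z = (f, e)` with `Λ`-KKT point `φ_Λ := 𝒢_Λ f + ℋ_Λ e`: (P) `⟨z, (B_H − B_Λ)z⟩ = ⟨φ_Λ, (Λ − H)φ_Λ⟩ + ⟨φ_Λ − φ_H, H(φ_Λ − φ_H)⟩` (idea-1's
(a)); (S) `H ⪰ 0, Λ − H ⪰ 0 ⟹ ⟨φ_Λ, (Λ − H)φ_Λ⟩ ≤ ⟨z, (B_H − B_Λ)z⟩ ≤ 2·(⟨f, (𝒢_H − 𝒢_Λ)f⟩ + ⟨e, (𝒮_Λ − 𝒮_H)e⟩)`; (J) `dℋ = 𝒢·(Q₁ᵀ𝒮 − K₁ℋ) + ℋ·(−Q₁ℋ)`,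
`(jet₂)₁₂ = 𝒢·(Q₁ᵀd𝒮′ − K₁dℋ′) + ℋ·(−Q₁dℋ′)`; so (CONS♭) at one level ⇐ (FLUC-OP) `𝒢_H − 𝒢_Λ ≤ C_G` + (SRC) `‖(Q₁ᵀ𝒮_Λ − Λ₁ℋ_Λ)e‖² ≤ F`,
`‖Q₁ℋ_Λ e‖² ≤ U` + the (CONS) VALUE row `𝒮_Λ − 𝒮_H ≤ C_S` (§5; the tower END with `θ^j`, `𝒮_Λ = 𝒮_{j+1}`, `ℋ_Λ = ℋ̃_j` is PART 43).

WHAT THIS FILE PROVES (0 sorry, 0 `def`, nothing cited):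
* §1 (any field) `kkt_eq_kkt_add_kkt_sub`, `kkt_zero_eq_fromBlocks`, `kkt_sub_kkt`, **`kktInv_sub_kktInv`** ∕ `kktInv_sub_kktInv'` (R),
  **`kktInv_sub_kktInv_gram`** (G), `kkt_transpose`, `kktInv_transpose_of_symm`, `flucCov_mul_mul_flucCov` (`𝒢K𝒢 = 𝒢`).
* §2 (any field) block readings: `kktInv_mulVec` (`B_K(f,e) = (𝒢f + ℋe, ℋᴸf − 𝒮e)`), `kkt_zero_mulVec`, `kktPoint_constraint` (`Qφ = e`),
  `kktPoint_stationarity` (`Kφ + Qᵀ(ℋᴸf − 𝒮e) = f`), `pairing_eq` (`⟨z, B_K z⟩ = ⟨f,𝒢f⟩ + ⟨f,ℋe⟩ + ⟨e,ℋᴸf⟩ − ⟨e,𝒮e⟩`).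
* §3 (`ℝ`, symmetric data) `dotProduct_mulVec_symm`, `dotProduct_flucCov_nonneg`, **`pairing_sub_pairing_eq`**, `kktPoint_sub` (`φ_Λ − φ_H = −𝒢_H(Λ − H)φ_Λ`),
  **`pairing_sub_pairing_eq_gram`** (P), **`constrained_energy_le_pairing_sub`** (S, left), `pairing_sub_expand`, **`pairing_sub_le_two_rows`** (S, right),
  **`constrained_energy_le_two_rows`**, `constrained_energy_le_of_rows` (constants `C_G, C_S`), and the H-SIDE companion **`constrained_energy_H_le`**
  (`⟨φ_H, (Λ − H)φ_H⟩ ≤ 2(1 + c_D)·⟨z, (B_H − B_Λ)z⟩` from `Λ − H ≤ c_D·H` on `ker Q`).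
* §4 (any field) **`dMinOp_eq_kktPoint`**, `dMinOp_mulVec_eq_kktPoint`, **`jet₂_minOp_eq_kktPoint`** (J).
* §5 (`ℝ`) **`jet_constrained_energy_le_two_rows`** and **`jet_constrained_energy_le_of_rows`** — (CONS♭) AT ONE LEVEL from (FLUC-OP) + (SRC) + the (CONS)
  value row, `Λ − H ⪰ 0` and `H ⪰ 0`.
WHAT IT DOES NOT DO: supply (FLUC-OP), (SRC) or the (CONS) value row for any of Bałaban's operators (OPEN support rows, PRICING-GAN24 v3.42 Q-49-1∕2;
toy t49 numbers are gan24-idea-1's, not theorems); identify the jet direction `(Λ₁, Q₁)` of a true tower (PART 43 names it); assert anything printed.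
SUPPLIER work on route R6 (rank 2, REDUCTION, no seat); no consumer of record; NEVER «G-an2-4 closed»; NOT (CONV-C), NOT D1, NOT `BetaPertH`, NOT continuum,
NOT Clay.  Records: `HOME/b2b-balaban-gan24-p3/WOODBURY-FIBRE.md` v14.0.
-/

noncomputable section

open Matrix

namespace Summit.QuantumFields.BalabanUV.Beta.GAN24.DerivativeRateTransferKKTSources

open Literature.MathematicalPhysics.QuantumFieldTheory.Balaban1983to89.Beta.Composition (kkt)
open Literature.MathematicalPhysics.QuantumFieldTheory.Balaban1983to89.Beta.CompositionSingular (effForm minOp minOpL flucCov kkt_eq_fromBlocks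
  kktInv_eq_fromBlocks kkt_mul_blocks blocks_mul_kkt mul_minOp mul_flucCov minOpL_eq_transpose)
open Literature.MathematicalPhysics.QuantumFieldTheory.Balaban1983to89.Beta.BorderedJets (kkt_add dMinOp dEffForm jet₂ dMinOp_eq jet₂_toBlocks₁₂)
open Summit.QuantumFields.BalabanUV.Beta.GAN24.DerivativeRateTransferLoewnerKKT (transpose_eq_of_posSemidef mulVec_dotProduct_eq)
open Summit.QuantumFields.BalabanUV.Beta.GAN24.DerivativeRateTransferSqueezeEnd (dotProduct_mulVec_add_le)

/-! ## §1 Two fine forms at a common constraint: the bordered resolvent identities (any field) -/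

section Resolvent

variable {𝕜 : Type*} [Field 𝕜]
variable {ν μ : Type*} [Fintype ν] [Fintype μ] [DecidableEq ν] [DecidableEq μ]

omit [Fintype ν] [Fintype μ] [DecidableEq ν] [DecidableEq μ] in
/-- [folklore] Two fine forms at ONE constraint differ by a bordered matrix with zero constraint rows: `kkt H Q = kkt Λ Q + kkt (H − Λ) 0`
(an1's `kkt_add`). -/
theorem kkt_eq_kkt_add_kkt_sub (H Λ : Matrix ν ν 𝕜) (Q : Matrix μ ν 𝕜) : kkt H Q = kkt Λ Q + kkt (H - Λ) 0 := by
  rw [← kkt_add, add_sub_cancel, add_zero]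

omit [Fintype ν] [Fintype μ] [DecidableEq ν] [DecidableEq μ] in
/-- [folklore] `kkt D 0 = [[D, 0],[0, 0]]`. -/
theorem kkt_zero_eq_fromBlocks (D : Matrix ν ν 𝕜) : kkt D (0 : Matrix μ ν 𝕜) = Matrix.fromBlocks D 0 0 0 := by
  rw [kkt_eq_fromBlocks, Matrix.transpose_zero]

omit [Fintype ν] [Fintype μ] [DecidableEq ν] [DecidableEq μ] in
/-- [folklore] `kkt Λ Q − kkt H Q = kkt (Λ − H) 0`. -/
theorem kkt_sub_kkt (H Λ : Matrix ν ν 𝕜) (Q : Matrix μ ν 𝕜) : kkt Λ Q - kkt H Q = kkt (Λ - H) 0 := by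
  rw [kkt_eq_kkt_add_kkt_sub Λ H Q, add_sub_cancel_left]

omit [Fintype ν] [Fintype μ] [DecidableEq ν] [DecidableEq μ] in
/-- [folklore] `(kkt K Q)ᵀ = kkt Kᵀ Q`. -/
theorem kkt_transpose (K : Matrix ν ν 𝕜) (Q : Matrix μ ν 𝕜) : (kkt K Q)ᵀ = kkt Kᵀ Q := by
  rw [kkt_eq_fromBlocks, kkt_eq_fromBlocks, Matrix.fromBlocks_transpose, Matrix.transpose_transpose, Matrix.transpose_zero]

/-- [folklore] For symmetric `K` the bordered inverse is symmetric. -/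
theorem kktInv_transpose_of_symm {K : Matrix ν ν 𝕜} (Q : Matrix μ ν 𝕜) (hK : Kᵀ = K) : ((kkt K Q)⁻¹)ᵀ = (kkt K Q)⁻¹ := by
  rw [Matrix.transpose_nonsing_inv, kkt_transpose, hK]

/-- **`kktInv_sub_kktInv` — THE BORDERED RESOLVENT IDENTITY (R)** [folklore]: two fine forms `H, Λ` at one constraint `Q`, both bordered matrices nonsingular ⟹
`(kkt H Q)⁻¹ − (kkt Λ Q)⁻¹ = (kkt H Q)⁻¹ · kkt (Λ − H) 0 · (kkt Λ Q)⁻¹` (no symmetry, no invertibility of `H, Λ`). -/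
theorem kktInv_sub_kktInv (H Λ : Matrix ν ν 𝕜) (Q : Matrix μ ν 𝕜) (hH : IsUnit (kkt H Q).det) (hΛ : IsUnit (kkt Λ Q).det) :
    (kkt H Q)⁻¹ - (kkt Λ Q)⁻¹ = (kkt H Q)⁻¹ * kkt (Λ - H) 0 * (kkt Λ Q)⁻¹ := by
  rw [Matrix.inv_sub_inv (iff_of_true ((Matrix.isUnit_iff_isUnit_det _).mpr hH) ((Matrix.isUnit_iff_isUnit_det _).mpr hΛ)),
    kkt_sub_kkt]

/-- **`kktInv_sub_kktInv'` — (R), mirrored**: `(kkt H Q)⁻¹ − (kkt Λ Q)⁻¹ = (kkt Λ Q)⁻¹ · kkt (Λ − H) 0 · (kkt H Q)⁻¹`. [folklore] -/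
theorem kktInv_sub_kktInv' (H Λ : Matrix ν ν 𝕜) (Q : Matrix μ ν 𝕜) (hH : IsUnit (kkt H Q).det) (hΛ : IsUnit (kkt Λ Q).det) :
    (kkt H Q)⁻¹ - (kkt Λ Q)⁻¹ = (kkt Λ Q)⁻¹ * kkt (Λ - H) 0 * (kkt H Q)⁻¹ := by
  have h := kktInv_sub_kktInv Λ H Q hΛ hH
  have e : kkt (H - Λ) (0 : Matrix μ ν 𝕜) = -kkt (Λ - H) 0 := by
    rw [kkt_zero_eq_fromBlocks, kkt_zero_eq_fromBlocks, Matrix.fromBlocks_neg]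
    simp only [neg_zero, neg_sub]
  rw [show (kkt H Q)⁻¹ - (kkt Λ Q)⁻¹ = -((kkt Λ Q)⁻¹ - (kkt H Q)⁻¹) from (neg_sub _ _).symm, h, e, Matrix.mul_neg,
    Matrix.neg_mul, neg_neg]

/-- **`kktInv_sub_kktInv_gram` — THE GRAM FORM (G)** [folklore]: with `B_K := (kkt K Q)⁻¹`, `E := kkt (Λ − H) 0`,
`B_H − B_Λ = B_Λ·E·B_Λ + B_Λ·E·B_H·E·B_Λ` — substitute the mirrored resolvent identity `B_H = B_Λ + B_Λ·E·B_H` into the left factor of `B_H·E·B_Λ`.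
(For symmetric real data the second term is the Gram matrix of `B_H·E·B_Λ` in the `[[H,0],[0,0]]`-form, §3.) -/
theorem kktInv_sub_kktInv_gram (H Λ : Matrix ν ν 𝕜) (Q : Matrix μ ν 𝕜) (hH : IsUnit (kkt H Q).det) (hΛ : IsUnit (kkt Λ Q).det) :
    (kkt H Q)⁻¹ - (kkt Λ Q)⁻¹ = (kkt Λ Q)⁻¹ * kkt (Λ - H) 0 * (kkt Λ Q)⁻¹ +
        (kkt Λ Q)⁻¹ * kkt (Λ - H) 0 * (kkt H Q)⁻¹ * kkt (Λ - H) 0 * (kkt Λ Q)⁻¹ := by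
  have h1 := kktInv_sub_kktInv H Λ Q hH hΛ
  have h2 : (kkt H Q)⁻¹ = (kkt Λ Q)⁻¹ + (kkt Λ Q)⁻¹ * kkt (Λ - H) 0 * (kkt H Q)⁻¹ := by
    rw [← sub_eq_iff_eq_add']
    exact kktInv_sub_kktInv' H Λ Q hH hΛ
  calc (kkt H Q)⁻¹ - (kkt Λ Q)⁻¹ = (kkt H Q)⁻¹ * kkt (Λ - H) 0 * (kkt Λ Q)⁻¹ := h1
    _ = ((kkt Λ Q)⁻¹ + (kkt Λ Q)⁻¹ * kkt (Λ - H) 0 * (kkt H Q)⁻¹) * kkt (Λ - H) 0 * (kkt Λ Q)⁻¹ := by rw [← h2]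
    _ = _ := by rw [Matrix.add_mul, Matrix.add_mul]

/-- [folklore] `𝒢·K·𝒢 = 𝒢` (from an2's `𝒢K + ℋQ = 1` and `Q𝒢 = 0`; no symmetry, no invertibility of `K`). -/
theorem flucCov_mul_mul_flucCov (K : Matrix ν ν 𝕜) (Q : Matrix μ ν 𝕜) (h : IsUnit (kkt K Q).det) :
    flucCov K Q * K * flucCov K Q = flucCov K Q := by
  have h1 : flucCov K Q * K + minOp K Q * Q = 1 := (blocks_mul_kkt K Q h).1
  have h2 : Q * flucCov K Q = 0 := mul_flucCov K Q h
  calc flucCov K Q * K * flucCov K Q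
        = (flucCov K Q * K + minOp K Q * Q) * flucCov K Q - minOp K Q * (Q * flucCov K Q) := by
          rw [Matrix.add_mul, Matrix.mul_assoc (minOp K Q), add_sub_cancel_right]
    _ = flucCov K Q := by rw [h1, h2, Matrix.one_mul, Matrix.mul_zero, sub_zero]

/-! ## §2 Block readings: KKT points with sources (any field) -/

/-- **`kktInv_mulVec` — THE KKT POINT WITH SOURCES** [folklore]: at a source pair `z = (f, e)` (fine source `f`, constraint value `e`),
`(kkt K Q)⁻¹ z = (𝒢_K f + ℋ_K e, ℋᴸ_K f − 𝒮_K e)` — the primal component `φ_K(z) := 𝒢_K f + ℋ_K e` and (minus) the multiplier. -/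
theorem kktInv_mulVec (K : Matrix ν ν 𝕜) (Q : Matrix μ ν 𝕜) (f : ν → 𝕜) (e : μ → 𝕜) :
    (kkt K Q)⁻¹ *ᵥ Sum.elim f e = Sum.elim (flucCov K Q *ᵥ f + minOp K Q *ᵥ e) (minOpL K Q *ᵥ f - effForm K Q *ᵥ e) := by
  rw [kktInv_eq_fromBlocks, Matrix.fromBlocks_mulVec, Sum.elim_comp_inl, Sum.elim_comp_inr, Matrix.neg_mulVec, ← sub_eq_add_neg]

omit [DecidableEq ν] [DecidableEq μ] in
/-- [folklore] `kkt D 0 · (φ, ψ) = (Dφ, 0)`. -/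
theorem kkt_zero_mulVec (D : Matrix ν ν 𝕜) (φ : ν → 𝕜) (ψ : μ → 𝕜) :
    kkt D (0 : Matrix μ ν 𝕜) *ᵥ Sum.elim φ ψ = Sum.elim (D *ᵥ φ) 0 := by
  rw [kkt_zero_eq_fromBlocks, Matrix.fromBlocks_mulVec, Sum.elim_comp_inl, Sum.elim_comp_inr]
  simp only [Matrix.zero_mulVec, add_zero]

/-- [folklore] the KKT point meets its constraint value: `Q·(𝒢_K f + ℋ_K e) = e`. -/
theorem kktPoint_constraint (K : Matrix ν ν 𝕜) (Q : Matrix μ ν 𝕜) (h : IsUnit (kkt K Q).det) (f : ν → 𝕜) (e : μ → 𝕜) :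
    Q *ᵥ (flucCov K Q *ᵥ f + minOp K Q *ᵥ e) = e := by
  rw [mulVec_add, mulVec_mulVec, mulVec_mulVec, mul_flucCov K Q h, mul_minOp K Q h, Matrix.zero_mulVec, Matrix.one_mulVec, zero_add]

/-- [folklore] stationarity of the KKT point: `K·(𝒢_K f + ℋ_K e) + Qᵀ·(ℋᴸ_K f − 𝒮_K e) = f`. -/
theorem kktPoint_stationarity (K : Matrix ν ν 𝕜) (Q : Matrix μ ν 𝕜) (h : IsUnit (kkt K Q).det) (f : ν → 𝕜) (e : μ → 𝕜) :
    K *ᵥ (flucCov K Q *ᵥ f + minOp K Q *ᵥ e) + Qᵀ *ᵥ (minOpL K Q *ᵥ f - effForm K Q *ᵥ e) = f := by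
  obtain ⟨h11, h12, -, -⟩ := kkt_mul_blocks K Q h
  rw [mulVec_add, mulVec_sub, mulVec_mulVec, mulVec_mulVec, mulVec_mulVec, mulVec_mulVec, h12, add_add_sub_cancel, ← add_mulVec, h11,
    Matrix.one_mulVec]

/-- **`pairing_eq` — THE VALUE IS THE BORDERED PAIRING** [folklore]: `⟨z, (kkt K Q)⁻¹ z⟩ = ⟨f, 𝒢_K f⟩ + ⟨f, ℋ_K e⟩ + (⟨e, ℋᴸ_K f⟩ − ⟨e, 𝒮_K e⟩)`
(idea-1's `qfun_kkt_value`: the value of «max 2⟨f,φ⟩ − ⟨φ,Kφ⟩ subject to `Qφ = e`» is `⟨f,φ⟩ − ⟨e,λ⟩`). -/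
theorem pairing_eq (K : Matrix ν ν 𝕜) (Q : Matrix μ ν 𝕜) (f : ν → 𝕜) (e : μ → 𝕜) :
    Sum.elim f e ⬝ᵥ ((kkt K Q)⁻¹ *ᵥ Sum.elim f e) =
      f ⬝ᵥ (flucCov K Q *ᵥ f) + f ⬝ᵥ (minOp K Q *ᵥ e) + (e ⬝ᵥ (minOpL K Q *ᵥ f) - e ⬝ᵥ (effForm K Q *ᵥ e)) := by
  rw [kktInv_mulVec, sumElim_dotProduct_sumElim, dotProduct_add, dotProduct_sub]

end Resolvent

/-! ## §3 Symmetric real data: KKT Pythagoras with sources, the squeeze, the two-row bound -/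

section Real

variable {ν μ : Type*} [Fintype ν] [Fintype μ] [DecidableEq ν] [DecidableEq μ]
variable {H Λ : Matrix ν ν ℝ} {Q : Matrix μ ν ℝ}

omit [DecidableEq ν] in
/-- [folklore] a symmetric real matrix moves across the dot product: `Mᵀ = M ⟹ ⟨v, Mw⟩ = ⟨Mv, w⟩`. -/
theorem dotProduct_mulVec_symm {M : Matrix ν ν ℝ} (hM : Mᵀ = M) (v w : ν → ℝ) : v ⬝ᵥ (M *ᵥ w) = (M *ᵥ v) ⬝ᵥ w := by
  rw [mulVec_dotProduct_eq, hM]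

/-- [folklore] `H ⪰ 0 ⟹ ⟨x, 𝒢_H x⟩ = ⟨𝒢_H x, H 𝒢_H x⟩ ≥ 0` (by `𝒢H𝒢 = 𝒢` and the symmetry of `𝒢`). -/
theorem dotProduct_flucCov_nonneg (hHp : H.PosSemidef) (h : IsUnit (kkt H Q).det) (x : ν → ℝ) : 0 ≤ x ⬝ᵥ (flucCov H Q *ᵥ x) := by
  have hGt : (flucCov H Q)ᵀ = flucCov H Q := (minOpL_eq_transpose H Q (transpose_eq_of_posSemidef hHp)).2.1
  have e : x ⬝ᵥ (flucCov H Q *ᵥ x) = (flucCov H Q *ᵥ x) ⬝ᵥ (H *ᵥ (flucCov H Q *ᵥ x)) := by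
    conv_lhs => rw [← flucCov_mul_mul_flucCov H Q h]
    rw [← mulVec_mulVec, ← mulVec_mulVec, dotProduct_mulVec_symm hGt]
  have := hHp.dotProduct_mulVec_nonneg (flucCov H Q *ᵥ x)
  rwa [e, star_trivial] at *

/-- **`pairing_sub_pairing_eq`** [folklore]: symmetric `H, Λ`, both bordered matrices nonsingular, `z = (f, e)`, `φ_Λ := 𝒢_Λ f + ℋ_Λ e` ⟹
`⟨z, ((kkt H Q)⁻¹ − (kkt Λ Q)⁻¹) z⟩ = ⟨φ_Λ, (Λ − H)φ_Λ⟩ + ⟨(Λ − H)φ_Λ, 𝒢_H (Λ − H)φ_Λ⟩` — the Gram form (G) read at one source. -/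
theorem pairing_sub_pairing_eq (hHs : Hᵀ = H) (hΛs : Λᵀ = Λ) (hH : IsUnit (kkt H Q).det) (hΛ : IsUnit (kkt Λ Q).det)
    (f : ν → ℝ) (e : μ → ℝ) :
    Sum.elim f e ⬝ᵥ (((kkt H Q)⁻¹ - (kkt Λ Q)⁻¹) *ᵥ Sum.elim f e) =
      (flucCov Λ Q *ᵥ f + minOp Λ Q *ᵥ e) ⬝ᵥ ((Λ - H) *ᵥ (flucCov Λ Q *ᵥ f + minOp Λ Q *ᵥ e)) +
        ((Λ - H) *ᵥ (flucCov Λ Q *ᵥ f + minOp Λ Q *ᵥ e)) ⬝ᵥ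
          (flucCov H Q *ᵥ ((Λ - H) *ᵥ (flucCov Λ Q *ᵥ f + minOp Λ Q *ᵥ e))) := by
  have hBΛ : ((kkt Λ Q)⁻¹)ᵀ = (kkt Λ Q)⁻¹ := kktInv_transpose_of_symm Q hΛs
  have hE : (kkt (Λ - H) (0 : Matrix μ ν ℝ))ᵀ = kkt (Λ - H) 0 := by
    rw [kkt_transpose, Matrix.transpose_sub, hΛs, hHs]
  rw [kktInv_sub_kktInv_gram H Λ Q hH hΛ, add_mulVec, dotProduct_add]
  congr 1
  · rw [← mulVec_mulVec, ← mulVec_mulVec, dotProduct_mulVec_symm hBΛ, kktInv_mulVec, kkt_zero_mulVec, sumElim_dotProduct_sumElim,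
      dotProduct_zero, add_zero]
  · rw [← mulVec_mulVec, ← mulVec_mulVec, ← mulVec_mulVec, ← mulVec_mulVec, dotProduct_mulVec_symm hBΛ, kktInv_mulVec, kkt_zero_mulVec,
      dotProduct_mulVec_symm hE, kkt_zero_mulVec, kktInv_mulVec, sumElim_dotProduct_sumElim, mulVec_zero, add_zero, zero_dotProduct,
      add_zero]

/-- **`kktPoint_sub`** [folklore]: the two KKT points of the SAME source differ by a fluctuation: `φ_Λ − φ_H = −𝒢_H (Λ − H) φ_Λ` (primal row of (R)). -/
theorem kktPoint_sub (hH : IsUnit (kkt H Q).det) (hΛ : IsUnit (kkt Λ Q).det) (f : ν → ℝ) (e : μ → ℝ) :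
    (flucCov Λ Q *ᵥ f + minOp Λ Q *ᵥ e) - (flucCov H Q *ᵥ f + minOp H Q *ᵥ e) =
      -(flucCov H Q *ᵥ ((Λ - H) *ᵥ (flucCov Λ Q *ᵥ f + minOp Λ Q *ᵥ e))) := by
  have hv := congrArg (fun M : Matrix (ν ⊕ μ) (ν ⊕ μ) ℝ => M *ᵥ Sum.elim f e) (kktInv_sub_kktInv H Λ Q hH hΛ)
  simp only [sub_mulVec, ← mulVec_mulVec, kktInv_mulVec, kkt_zero_mulVec, mulVec_zero, add_zero] at hv
  ext i
  have hi := congrFun hv (Sum.inl i)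
  simp only [Pi.sub_apply, Sum.elim_inl, Pi.neg_apply, sub_mulVec] at hi ⊢
  linarith

/-- **`pairing_sub_pairing_eq_gram` — KKT PYTHAGORAS WITH SOURCES (P)** [folklore; gan24-idea-1 g49 LENS ITEM 6 (a), re-typed in bordered letters]:
symmetric `H, Λ`, nonsingular bordered matrices, `z = (f,e)`, `φ_K := 𝒢_K f + ℋ_K e` ⟹
`⟨z, ((kkt H Q)⁻¹ − (kkt Λ Q)⁻¹) z⟩ = ⟨φ_Λ, (Λ − H)φ_Λ⟩ + ⟨φ_Λ − φ_H, H(φ_Λ − φ_H)⟩`.  No positivity and no relation `H ≤ Λ` is needed. -/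
theorem pairing_sub_pairing_eq_gram (hHs : Hᵀ = H) (hΛs : Λᵀ = Λ) (hH : IsUnit (kkt H Q).det) (hΛ : IsUnit (kkt Λ Q).det)
    (f : ν → ℝ) (e : μ → ℝ) :
    Sum.elim f e ⬝ᵥ (((kkt H Q)⁻¹ - (kkt Λ Q)⁻¹) *ᵥ Sum.elim f e) =
      (flucCov Λ Q *ᵥ f + minOp Λ Q *ᵥ e) ⬝ᵥ ((Λ - H) *ᵥ (flucCov Λ Q *ᵥ f + minOp Λ Q *ᵥ e)) +
        ((flucCov Λ Q *ᵥ f + minOp Λ Q *ᵥ e) - (flucCov H Q *ᵥ f + minOp H Q *ᵥ e)) ⬝ᵥ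
          (H *ᵥ ((flucCov Λ Q *ᵥ f + minOp Λ Q *ᵥ e) - (flucCov H Q *ᵥ f + minOp H Q *ᵥ e))) := by
  have hGt : (flucCov H Q)ᵀ = flucCov H Q := (minOpL_eq_transpose H Q hHs).2.1
  rw [pairing_sub_pairing_eq hHs hΛs hH hΛ, kktPoint_sub hH hΛ, neg_dotProduct, mulVec_neg, dotProduct_neg, neg_neg]
  congr 1
  set w : ν → ℝ := (Λ - H) *ᵥ (flucCov Λ Q *ᵥ f + minOp Λ Q *ᵥ e)
  conv_lhs => rw [← flucCov_mul_mul_flucCov H Q hH]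
  rw [← mulVec_mulVec, ← mulVec_mulVec, dotProduct_mulVec_symm hGt]

/-- **`constrained_energy_le_pairing_sub` — THE SQUEEZE (S, left)** [folklore; gan24-idea-1 g49 `constrained_energy_le` re-typed]: `H ⪰ 0`, `Λ` symmetric ⟹
`⟨φ_Λ, (Λ − H)φ_Λ⟩ ≤ ⟨z, ((kkt H Q)⁻¹ − (kkt Λ Q)⁻¹) z⟩` — the constrained `(Λ − H)`-energy of the `Λ`-KKT point is below the bordered difference pairing. -/
theorem constrained_energy_le_pairing_sub (hHp : H.PosSemidef) (hΛs : Λᵀ = Λ) (hH : IsUnit (kkt H Q).det) (hΛ : IsUnit (kkt Λ Q).det)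
    (f : ν → ℝ) (e : μ → ℝ) :
    (flucCov Λ Q *ᵥ f + minOp Λ Q *ᵥ e) ⬝ᵥ ((Λ - H) *ᵥ (flucCov Λ Q *ᵥ f + minOp Λ Q *ᵥ e)) ≤
      Sum.elim f e ⬝ᵥ (((kkt H Q)⁻¹ - (kkt Λ Q)⁻¹) *ᵥ Sum.elim f e) := by
  rw [pairing_sub_pairing_eq (transpose_eq_of_posSemidef hHp) hΛs hH hΛ]
  exact le_add_of_nonneg_right (dotProduct_flucCov_nonneg hHp hH _)

/-- **`pairing_sub_expand`** [folklore]: for symmetric data the bordered difference pairing in the three block rows: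
`⟨z, (B_H − B_Λ) z⟩ = ⟨f, (𝒢_H − 𝒢_Λ)f⟩ + 2⟨f, (ℋ_H − ℋ_Λ)e⟩ − ⟨e, (𝒮_H − 𝒮_Λ)e⟩`. -/
theorem pairing_sub_expand (hHs : Hᵀ = H) (hΛs : Λᵀ = Λ) (f : ν → ℝ) (e : μ → ℝ) :
    Sum.elim f e ⬝ᵥ (((kkt H Q)⁻¹ - (kkt Λ Q)⁻¹) *ᵥ Sum.elim f e) =
      f ⬝ᵥ ((flucCov H Q - flucCov Λ Q) *ᵥ f) + 2 * (f ⬝ᵥ ((minOp H Q - minOp Λ Q) *ᵥ e)) -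
        e ⬝ᵥ ((effForm H Q - effForm Λ Q) *ᵥ e) := by
  have tH : e ⬝ᵥ (minOpL H Q *ᵥ f) = f ⬝ᵥ (minOp H Q *ᵥ e) := by
    rw [(minOpL_eq_transpose H Q hHs).1, ← mulVec_dotProduct_eq, dotProduct_comm]
  have tΛ : e ⬝ᵥ (minOpL Λ Q *ᵥ f) = f ⬝ᵥ (minOp Λ Q *ᵥ e) := by
    rw [(minOpL_eq_transpose Λ Q hΛs).1, ← mulVec_dotProduct_eq, dotProduct_comm]
  rw [sub_mulVec, dotProduct_sub, pairing_eq, pairing_eq, tH, tΛ]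
  simp only [sub_mulVec, dotProduct_sub]
  ring

/-- **`pairing_sub_le_two_rows` — THE TWO-ROW BOUND (S, right)** [folklore; gan24-idea-1 g49 (b)]: `H ⪰ 0`, `Λ − H ⪰ 0` ⟹ the bordered difference is positive
semidefinite and hence `⟨z, (B_H − B_Λ)z⟩ ≤ 2·(⟨f, (𝒢_H − 𝒢_Λ)f⟩ + ⟨e, (𝒮_Λ − 𝒮_H)e⟩)` (test `(f, −e)`; the mixed row `ℋ_H − ℋ_Λ` drops out). -/
theorem pairing_sub_le_two_rows (hHp : H.PosSemidef) (hΛs : Λᵀ = Λ) (hD : (Λ - H).PosSemidef) (hH : IsUnit (kkt H Q).det)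
    (hΛ : IsUnit (kkt Λ Q).det) (f : ν → ℝ) (e : μ → ℝ) :
    Sum.elim f e ⬝ᵥ (((kkt H Q)⁻¹ - (kkt Λ Q)⁻¹) *ᵥ Sum.elim f e) ≤
      2 * (f ⬝ᵥ ((flucCov H Q - flucCov Λ Q) *ᵥ f) + e ⬝ᵥ ((effForm Λ Q - effForm H Q) *ᵥ e)) := by
  have hHs : Hᵀ = H := transpose_eq_of_posSemidef hHp
  have hpos : 0 ≤ Sum.elim f (-e) ⬝ᵥ (((kkt H Q)⁻¹ - (kkt Λ Q)⁻¹) *ᵥ Sum.elim f (-e)) := by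
    refine le_trans ?_ (constrained_energy_le_pairing_sub hHp hΛs hH hΛ f (-e))
    have := hD.dotProduct_mulVec_nonneg (flucCov Λ Q *ᵥ f + minOp Λ Q *ᵥ (-e))
    rwa [star_trivial] at this
  have hS : e ⬝ᵥ ((effForm Λ Q - effForm H Q) *ᵥ e) = -(e ⬝ᵥ ((effForm H Q - effForm Λ Q) *ᵥ e)) := by
    rw [← neg_sub, neg_mulVec, dotProduct_neg]
  rw [pairing_sub_expand hHs hΛs] at hpos ⊢
  simp only [mulVec_neg, dotProduct_neg, neg_dotProduct, neg_neg] at hpos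
  rw [hS]; linarith

/-- **`constrained_energy_le_two_rows` — (CONS♭)'s ONE-LEVEL MECHANISM** [our proof; gan24-idea-1 g49 LENS ITEM 6]: `H ⪰ 0`, `Λ` symmetric with `Λ − H ⪰ 0`,
nonsingular bordered matrices ⟹ for every source pair `(f, e)` the `Λ`-KKT point `φ_Λ = 𝒢_Λ f + ℋ_Λ e` satisfies
`⟨φ_Λ, (Λ − H)φ_Λ⟩ ≤ 2·(⟨f, (𝒢_H − 𝒢_Λ)f⟩ + ⟨e, (𝒮_Λ − 𝒮_H)e⟩)` — a FLUCTUATION-COVARIANCE difference row on the fine source and an EFFECTIVE-FORM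
difference row on the constraint source; no rate enters. -/
theorem constrained_energy_le_two_rows (hHp : H.PosSemidef) (hΛs : Λᵀ = Λ) (hD : (Λ - H).PosSemidef) (hH : IsUnit (kkt H Q).det)
    (hΛ : IsUnit (kkt Λ Q).det) (f : ν → ℝ) (e : μ → ℝ) :
    (flucCov Λ Q *ᵥ f + minOp Λ Q *ᵥ e) ⬝ᵥ ((Λ - H) *ᵥ (flucCov Λ Q *ᵥ f + minOp Λ Q *ᵥ e)) ≤
      2 * (f ⬝ᵥ ((flucCov H Q - flucCov Λ Q) *ᵥ f) + e ⬝ᵥ ((effForm Λ Q - effForm H Q) *ᵥ e)) :=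
  (constrained_energy_le_pairing_sub hHp hΛs hH hΛ f e).trans (pairing_sub_le_two_rows hHp hΛs hD hH hΛ f e)

/-- **`constrained_energy_le_of_rows`** [our proof]: the same with the two rows as FORM bounds with constants — (FLUC-OP) `⟨x, (𝒢_H − 𝒢_Λ)x⟩ ≤ C_G⟨x,x⟩`,
the (CONS) value row `⟨y, (𝒮_Λ − 𝒮_H)y⟩ ≤ C_S⟨y,y⟩` ⟹ `⟨φ_Λ, (Λ − H)φ_Λ⟩ ≤ 2·(C_G⟨f,f⟩ + C_S⟨e,e⟩)`. -/
theorem constrained_energy_le_of_rows (hHp : H.PosSemidef) (hΛs : Λᵀ = Λ) (hD : (Λ - H).PosSemidef) (hH : IsUnit (kkt H Q).det)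
    (hΛ : IsUnit (kkt Λ Q).det) {CG CS : ℝ} (hG : ∀ x : ν → ℝ, x ⬝ᵥ ((flucCov H Q - flucCov Λ Q) *ᵥ x) ≤ CG * (x ⬝ᵥ x))
    (hS : ∀ y : μ → ℝ, y ⬝ᵥ ((effForm Λ Q - effForm H Q) *ᵥ y) ≤ CS * (y ⬝ᵥ y)) (f : ν → ℝ) (e : μ → ℝ) :
    (flucCov Λ Q *ᵥ f + minOp Λ Q *ᵥ e) ⬝ᵥ ((Λ - H) *ᵥ (flucCov Λ Q *ᵥ f + minOp Λ Q *ᵥ e)) ≤ 2 * (CG * (f ⬝ᵥ f) + CS * (e ⬝ᵥ e)) := by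
  refine (constrained_energy_le_two_rows hHp hΛs hD hH hΛ f e).trans ?_
  linarith [hG f, hS e]

/-- **`constrained_energy_H_le` — THE H-SIDE COMPANION** [our proof; gan24-idea-1 g49 (b), «parallelogram in the `D₀`-seminorm»]: `H ⪰ 0`, `Λ − H ⪰ 0`,
and `Λ − H ≤ c_D·H` ON `ker Q` (`c_D ≥ 0`) ⟹ the `H`-KKT point `φ_H = 𝒢_H f + ℋ_H e` of the same source satisfies
`⟨φ_H, (Λ − H)φ_H⟩ ≤ 2(1 + c_D)·⟨z, ((kkt H Q)⁻¹ − (kkt Λ Q)⁻¹) z⟩` (by (P): `φ_H = φ_Λ − (φ_Λ − φ_H)` with `Q(φ_Λ − φ_H) = 0`). -/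
theorem constrained_energy_H_le (hHp : H.PosSemidef) (hΛs : Λᵀ = Λ) (hD : (Λ - H).PosSemidef) (hH : IsUnit (kkt H Q).det)
    (hΛ : IsUnit (kkt Λ Q).det) {cD : ℝ} (hcD : 0 ≤ cD) (hker : ∀ w : ν → ℝ, Q *ᵥ w = 0 → w ⬝ᵥ ((Λ - H) *ᵥ w) ≤ cD * (w ⬝ᵥ (H *ᵥ w)))
    (f : ν → ℝ) (e : μ → ℝ) :
    (flucCov H Q *ᵥ f + minOp H Q *ᵥ e) ⬝ᵥ ((Λ - H) *ᵥ (flucCov H Q *ᵥ f + minOp H Q *ᵥ e)) ≤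
      2 * (1 + cD) * (Sum.elim f e ⬝ᵥ (((kkt H Q)⁻¹ - (kkt Λ Q)⁻¹) *ᵥ Sum.elim f e)) := by
  have hHs : Hᵀ = H := transpose_eq_of_posSemidef hHp
  set φΛ : ν → ℝ := flucCov Λ Q *ᵥ f + minOp Λ Q *ᵥ e with hφΛ
  set φH : ν → ℝ := flucCov H Q *ᵥ f + minOp H Q *ᵥ e with hφH
  have hw : Q *ᵥ (φΛ - φH) = 0 := by
    rw [mulVec_sub, hφΛ, hφH, kktPoint_constraint Λ Q hΛ, kktPoint_constraint H Q hH, sub_self]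
  have hP := pairing_sub_pairing_eq_gram hHs hΛs hH hΛ f e
  rw [← hφΛ, ← hφH] at hP
  have e1 : φH = φΛ + (-(φΛ - φH)) := by abel
  have hpar := dotProduct_mulVec_add_le hD φΛ (-(φΛ - φH))
  rw [← e1, mulVec_neg, neg_dotProduct, dotProduct_neg, neg_neg] at hpar
  have hk := hker _ hw
  have hD0 : 0 ≤ φΛ ⬝ᵥ ((Λ - H) *ᵥ φΛ) := by
    have := hD.dotProduct_mulVec_nonneg φΛ; rwa [star_trivial] at this
  have hH0 : 0 ≤ (φΛ - φH) ⬝ᵥ (H *ᵥ (φΛ - φH)) := by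
    have := hHp.dotProduct_mulVec_nonneg (φΛ - φH); rwa [star_trivial] at this
  rw [hP]; nlinarith

end Real

/-! ## §4 Jets ARE KKT points with sources (any field; an1's `dMinOp`, `jet₂` BY NAME) -/

section Jets

variable {𝕜 : Type*} [Field 𝕜]
variable {ν μ : Type*} [Fintype ν] [Fintype μ] [DecidableEq ν] [DecidableEq μ]

/-- **`dMinOp_eq_kktPoint` — THE FIRST MINIMISER JET IS A KKT POINT WITH SOURCES (J)** [folklore; gan24-idea-1 g49 (b); an1's `dMinOp_eq` regrouped]:
`dℋ(K,Q;K₁,Q₁) = 𝒢_K·(Q₁ᵀ𝒮_K − K₁ℋ_K) + ℋ_K·(−Q₁ℋ_K)` — fine source `f₁ = Q₁ᵀ𝒮 − K₁ℋ` (per unit constraint value), constraint source `u₁ = −Q₁ℋ`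
(differentiate `Kℋ = Qᵀ𝒮`, `Qℋ = 1`). -/
theorem dMinOp_eq_kktPoint (K K₁ : Matrix ν ν 𝕜) (Q Q₁ : Matrix μ ν 𝕜) :
    dMinOp K Q K₁ Q₁ = flucCov K Q * (Q₁ᵀ * effForm K Q - K₁ * minOp K Q) + minOp K Q * (-(Q₁ * minOp K Q)) := by
  rw [dMinOp_eq, Matrix.mul_sub, Matrix.mul_neg, ← Matrix.mul_assoc, ← Matrix.mul_assoc, ← Matrix.mul_assoc]
  abel

/-- [folklore] (J) at one constraint value `e`: `dℋ e = 𝒢_K((Q₁ᵀ𝒮_K − K₁ℋ_K)e) + ℋ_K((−Q₁ℋ_K)e)`. -/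
theorem dMinOp_mulVec_eq_kktPoint (K K₁ : Matrix ν ν 𝕜) (Q Q₁ : Matrix μ ν 𝕜) (e : μ → 𝕜) :
    dMinOp K Q K₁ Q₁ *ᵥ e =
      flucCov K Q *ᵥ ((Q₁ᵀ * effForm K Q - K₁ * minOp K Q) *ᵥ e) + minOp K Q *ᵥ ((-(Q₁ * minOp K Q)) *ᵥ e) := by
  rw [dMinOp_eq_kktPoint, add_mulVec, ← mulVec_mulVec, ← mulVec_mulVec]

/-- **`jet₂_minOp_eq_kktPoint` — THE SECOND-ORDER VERTEX TERM IS A KKT POINT WITH SOURCES** [folklore; an1's `jet₂_toBlocks₁₂` regrouped]: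
`(jet₂ K Q K₁ Q₁ K₁′ Q₁′)₁₂ = 𝒢_K·(Q₁ᵀ·d𝒮′ − K₁·dℋ′) + ℋ_K·(−Q₁·dℋ′)` with `dℋ′ = dℋ(K,Q;K₁′,Q₁′)`, `d𝒮′ = d𝒮(K,Q;K₁′,Q₁′)` — the sources of the second jet are
first jets dressed by the first-order vertices (idea-1's `f_{j,2}, u_{j,2}`). -/
theorem jet₂_minOp_eq_kktPoint (K K₁ K₁' : Matrix ν ν 𝕜) (Q Q₁ Q₁' : Matrix μ ν 𝕜) :
    (jet₂ K Q K₁ Q₁ K₁' Q₁').toBlocks₁₂ =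
      flucCov K Q * (Q₁ᵀ * dEffForm K Q K₁' Q₁' - K₁ * dMinOp K Q K₁' Q₁') + minOp K Q * (-(Q₁ * dMinOp K Q K₁' Q₁')) := by
  rw [jet₂_toBlocks₁₂, Matrix.add_mul, neg_add, Matrix.mul_sub, Matrix.mul_neg, ← Matrix.mul_assoc, ← Matrix.mul_assoc, ← Matrix.mul_assoc]
  abel

end Jets

/-! ## §5 (CONS♭) at one level: the constrained energy of the minimiser jet from (FLUC-OP) + (SRC) + the (CONS) value row -/

section ConsFlat

variable {ν μ : Type*} [Fintype ν] [Fintype μ] [DecidableEq ν] [DecidableEq μ]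
variable {H Λ : Matrix ν ν ℝ} {Q : Matrix μ ν ℝ}

/-- **`jet_constrained_energy_le_two_rows` — (CONS♭) AT ONE LEVEL, EXACT ROWS** [our proof; gan24-idea-1 g49 LENS ITEM 6]: `H ⪰ 0`, `Λ` symmetric, `Λ − H ⪰ 0`,
nonsingular bordered matrices, ANY jet direction `(Λ₁, Q₁)` ⟹ with `f₁ := (Q₁ᵀ𝒮_Λ − Λ₁ℋ_Λ)e`, `u₁ := Q₁ℋ_Λ e`:
`⟨dℋ(Λ,Q;Λ₁,Q₁)e, (Λ − H)·dℋ(Λ,Q;Λ₁,Q₁)e⟩ ≤ 2·(⟨f₁, (𝒢_H − 𝒢_Λ)f₁⟩ + ⟨u₁, (𝒮_Λ − 𝒮_H)u₁⟩)`. -/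
theorem jet_constrained_energy_le_two_rows (hHp : H.PosSemidef) (hΛs : Λᵀ = Λ) (hD : (Λ - H).PosSemidef) (hH : IsUnit (kkt H Q).det)
    (hΛ : IsUnit (kkt Λ Q).det) (Λ₁ : Matrix ν ν ℝ) (Q₁ : Matrix μ ν ℝ) (e : μ → ℝ) :
    (dMinOp Λ Q Λ₁ Q₁ *ᵥ e) ⬝ᵥ ((Λ - H) *ᵥ (dMinOp Λ Q Λ₁ Q₁ *ᵥ e)) ≤
      2 * (((Q₁ᵀ * effForm Λ Q - Λ₁ * minOp Λ Q) *ᵥ e) ⬝ᵥ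
              ((flucCov H Q - flucCov Λ Q) *ᵥ ((Q₁ᵀ * effForm Λ Q - Λ₁ * minOp Λ Q) *ᵥ e)) +
            ((Q₁ * minOp Λ Q) *ᵥ e) ⬝ᵥ ((effForm Λ Q - effForm H Q) *ᵥ ((Q₁ * minOp Λ Q) *ᵥ e))) := by
  have key := constrained_energy_le_two_rows hHp hΛs hD hH hΛ ((Q₁ᵀ * effForm Λ Q - Λ₁ * minOp Λ Q) *ᵥ e)
    ((-(Q₁ * minOp Λ Q)) *ᵥ e)
  rw [dMinOp_mulVec_eq_kktPoint]
  have hu : ((-(Q₁ * minOp Λ Q)) *ᵥ e) ⬝ᵥ ((effForm Λ Q - effForm H Q) *ᵥ ((-(Q₁ * minOp Λ Q)) *ᵥ e)) =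
      ((Q₁ * minOp Λ Q) *ᵥ e) ⬝ᵥ ((effForm Λ Q - effForm H Q) *ᵥ ((Q₁ * minOp Λ Q) *ᵥ e)) := by
    rw [neg_mulVec, mulVec_neg, neg_dotProduct, dotProduct_neg, neg_neg]
  rwa [hu] at key

/-- **`jet_constrained_energy_le_of_rows` — (CONS♭) AT ONE LEVEL FROM THE THREE ROWS WITH CONSTANTS** [our proof]: (FLUC-OP) `⟨x,(𝒢_H − 𝒢_Λ)x⟩ ≤ C_G⟨x,x⟩`,
the (CONS) value row `⟨y,(𝒮_Λ − 𝒮_H)y⟩ ≤ C_S⟨y,y⟩`, (SRC) `⟨f₁,f₁⟩ ≤ F`, `⟨u₁,u₁⟩ ≤ U` (`C_G, C_S ≥ 0`) ⟹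
`⟨dℋ(Λ,Q;Λ₁,Q₁)e, (Λ − H)·dℋ(Λ,Q;Λ₁,Q₁)e⟩ ≤ 2·(C_G·F + C_S·U)`. -/
theorem jet_constrained_energy_le_of_rows (hHp : H.PosSemidef) (hΛs : Λᵀ = Λ) (hD : (Λ - H).PosSemidef) (hH : IsUnit (kkt H Q).det)
    (hΛ : IsUnit (kkt Λ Q).det) (Λ₁ : Matrix ν ν ℝ) (Q₁ : Matrix μ ν ℝ) (e : μ → ℝ) {CG CS F U : ℝ} (hCG : 0 ≤ CG) (hCS : 0 ≤ CS)
    (hG : ∀ x : ν → ℝ, x ⬝ᵥ ((flucCov H Q - flucCov Λ Q) *ᵥ x) ≤ CG * (x ⬝ᵥ x))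
    (hS : ∀ y : μ → ℝ, y ⬝ᵥ ((effForm Λ Q - effForm H Q) *ᵥ y) ≤ CS * (y ⬝ᵥ y))
    (hF : ((Q₁ᵀ * effForm Λ Q - Λ₁ * minOp Λ Q) *ᵥ e) ⬝ᵥ ((Q₁ᵀ * effForm Λ Q - Λ₁ * minOp Λ Q) *ᵥ e) ≤ F)
    (hU : ((Q₁ * minOp Λ Q) *ᵥ e) ⬝ᵥ ((Q₁ * minOp Λ Q) *ᵥ e) ≤ U) :
    (dMinOp Λ Q Λ₁ Q₁ *ᵥ e) ⬝ᵥ ((Λ - H) *ᵥ (dMinOp Λ Q Λ₁ Q₁ *ᵥ e)) ≤ 2 * (CG * F + CS * U) := by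
  refine (jet_constrained_energy_le_two_rows hHp hΛs hD hH hΛ Λ₁ Q₁ e).trans ?_
  have h1 := hG ((Q₁ᵀ * effForm Λ Q - Λ₁ * minOp Λ Q) *ᵥ e)
  have h2 := hS ((Q₁ * minOp Λ Q) *ᵥ e)
  nlinarith [mul_le_mul_of_nonneg_left hF hCG, mul_le_mul_of_nonneg_left hU hCS]

end ConsFlat

end Summit.QuantumFields.BalabanUV.Beta.GAN24.DerivativeRateTransferKKTSources
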